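import Literature.NumberTheory.EllipticCurves.KubertTateFiveMuDescentGaussianBox
import Literature.NumberTheory.EllipticCurves.KubertTate16883ShaFive
import Literature.NumberTheory.EllipticCurves.LeadingTermProofs
import Literature.NumberTheory.EllipticCurves.BSDSelmerParityDokchitserBaseChangeProofs
import Literature.NumberTheory.EllipticCurves.SelmerCorankHolds
import Literature.NumberTheory.EllipticCurves.QuadraticTwist
import Literature.NumberTheory.NumberFields.CyclotomicFieldFourPrimes
import Mathlib.NumberTheory.NumberField.Cyclotomic.Basic
import HarnessLib

/-!
# The first complete `5`-descent over `ℚ(i)` in the tree: `E_{168/83} ⊗ ℚ(i)` has rank `3` and `Ш[5^∞] = 0`;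
# its quadratic twist `E_{168/83}^{(-4)}/ℚ` has rank `0` and `t₅ = 0` — unconditionally, by descent alone

PROOF-ONLY file (theorems only, no definition, no named fact, no `sorry`), topic `NumberTheory/EllipticCurves`;
an INSTANCE of the `5`-isogeny descent of the Kubert–Tate family over the Gaussian field
(`KubertTateFiveMuDescentGaussianBox`: `ℤ/5`-side `KubertTateFiveSelmerTameGaussian`, `μ₅`-side
`KubertTateFiveMuDescentNumberField[Valuation]`) at `(m, n) = (168, 83)`:

  `E = E_{168/83} = [-85, -13944, -1157352, 0, 0]`, `Δ = -2¹⁵·3⁵·7⁵·83⁵·132049`, `rank E(ℚ) = 3`, `t₅(E) = 0`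
  (tree `KubertTate16883Descent`, by the descent over `ℚ`).

Over `K = ℚ(i) = ℚ(ζ₄)` (any `K` with `IsCyclotomicExtension {4} ℚ K`): the bad primes `2, 3, 7, 83, 132049` are
Gaussian-tame (`≢ 1 (mod 5)`; `132049 ≡ 4 (mod 5)` is `≡ 1 (mod 4)`, split, `N𝔭 = 132049 ≢ 1`); the primes of
`ℤ[i]` above `mn = 2³·3·7·83` are FOUR (`(1+i)`, and the inert `3, 7, 83`), so the box is `#Sel^{φ̂} ≤ 5⁴`, and it is
FULL because `rank E(ℚ(i)) ≥ rank E(ℚ) = 3` and `T = (0,0) ∈ E(ℚ(i))[5]`: `#(E(ℚ(i))/5E(ℚ(i))) ≥ 5⁴`.  Hence: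

* `shaCorank_five_eq_zero` — **`t₅(E_{168/83} ⊗ ℚ(i)) = 0`**, `sha_torsionBy_five_eq_bot` — `Ш(E ⊗ ℚ(i))[5] = 0`;
* `mordellWeilRank_eq_three` — **`rank E_{168/83}(ℚ(i)) = 3`**;
* `mordellWeilRank_twist_eq_zero` — **`rank E_{168/83}^{(-4)}(ℚ) = 0`** (`rank E(K) = rank E + rank E^{(d_K)}`,
  `d_{ℚ(i)} = -4`, tree `mordellWeilRank_baseChange_quadratic_holds`);
* `shaCorank_five_twist_eq_zero` — **`t₅(E_{168/83}^{(-4)}/ℚ) = 0`** (`t₅(E_K) = t₅(E) + t₅(E^{(-4)})` from the tree's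
  `selmerCorank_baseChange_quadratic_holds` and Greenberg's identity).

The twist `E^{(-4)}` (`≅ E^{(-1)}`) has NO rational `5`-torsion point; `t₅ = 0` and rank `0` for it are obtained
here with no `L`-function, no `p`-adic and no conjectural input (for a rank-`0` curve the finiteness of `Ш[5^∞]` is
otherwise Kolyvagin's theorem, which needs `L(E^{(-4)}, 1) ≠ 0`).  The reference point of the `μ₅`-side is
`P₁ = (-156, 1143792) ∈ E(ℚ) ⊂ E(ℚ(i))` (`25 P₁ ≠ O` transported from `ℚ`, tree `KubertTateFiveTorsion`).

## References

* [SilvermanAEC2009] J. H. Silverman, *AEC*, 2nd ed., Thm. X.4.2, Prop. X.4.9, Exercise 10.1(c), Exercise 10.16.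
* [Fisher2001FiveSevenDescent] T. Fisher, JEMS 3 (2001), §§1–2.
* [IrelandRosen1982] K. Ireland, M. Rosen, *A Classical Introduction to Modern Number Theory*, Ch. 9 §7 Lemmas 3–5.
* [Dokchitser2013ParityNotes] T. Dokchitser, Notes on the parity conjecture (2013), §4.
-/

noncomputable section

open scoped Classical NNReal NumberField AddSubgroup
open WeierstrassCurve WeierstrassCurve.Isogeny Field IsDedekindDomain Ideal
open Literature.NumberTheory.EllipticCurves Literature.NumberTheory.EllipticCurves.KubertTateVelu
  Literature.NumberTheory.EllipticCurves.KubertTateMuDescentNF Literature.NumberTheory.NumberFields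

namespace Literature.NumberTheory.EllipticCurves

namespace KubertTate16883GaussianDescent

variable {K : Type} [Field K] [NumberField K] [IsCyclotomicExtension {4} ℚ K]

/-! ## §1 The curve over `ℚ(i)`: ellipticity and Gaussian tameness -/

omit [IsCyclotomicExtension {4} ℚ K] in
/-- `E_{168/83} ⊗ ℚ(i)` is elliptic (`Δ = -69610056646494231140990976 ≠ 0`). [cite: Kubert1976, Table 3 (N = 5)] -/
theorem isElliptic : (kubertTateFive ((168 : ℤ) : K) ((83 : ℤ) : K)).IsElliptic := by
  refine ⟨isUnit_iff_ne_zero.mpr ?_⟩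
  rw [KubertTateVelu.eq_map_int_of_field (K := K) 168 83, map_Δ, KubertTate16883Descent.Δ_int]
  norm_num

/-- **Gaussian tameness of `E_{168/83}`**: every bad prime `ℓ ∈ {2, 3, 7, 83, 132049}` is `≢ 1 (mod 5)`, and the
one that is `≡ 4 (mod 5)`, `132049`, is `≡ 1 (mod 4)` (it splits in `ℤ[i]`). [cite: Fisher2001FiveSevenDescent, §2]
[cite: IrelandRosen1982, Ch. 9 §7 Lemma 5] -/
theorem gaussian_tame : ∀ ℓ : ℕ, ℓ.Prime → (ℓ : ℤ) ∣ (kubertTateFive (168 : ℤ) 83).Δ →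
    ℓ % 5 ≠ 1 ∧ (ℓ % 5 = 4 → ℓ % 4 = 1) := by
  intro p hp hdvd
  refine ⟨KubertTate16883Descent.tame p hp hdvd, fun h4 ↦ ?_⟩
  rw [KubertTate16883Descent.Δ_int] at hdvd
  have hdvdN : p ∣ 2 ^ 15 * 3 ^ 5 * 7 ^ 5 * 83 ^ 5 * 132049 := by
    have h' : (p : ℤ) ∣ ((2 ^ 15 * 3 ^ 5 * 7 ^ 5 * 83 ^ 5 * 132049 : ℕ) : ℤ) := by
      have e : ((2 ^ 15 * 3 ^ 5 * 7 ^ 5 * 83 ^ 5 * 132049 : ℕ) : ℤ) = 69610056646494231140990976 := by norm_num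
      rw [e]; exact (Int.dvd_neg.mpr hdvd)
    exact Int.natCast_dvd_natCast.mp h'
  have hpi := Nat.Prime.prime hp
  rcases hpi.dvd_or_dvd hdvdN with h | h
  · rcases hpi.dvd_or_dvd h with h | h
    · rcases hpi.dvd_or_dvd h with h | h
      · rcases hpi.dvd_or_dvd h with h | h
        · have := (Nat.prime_dvd_prime_iff_eq hp Nat.prime_two).mp (hpi.dvd_of_dvd_pow h); omega
        · have := (Nat.prime_dvd_prime_iff_eq hp Nat.prime_three).mp (hpi.dvd_of_dvd_pow h); omega
      · have := (Nat.prime_dvd_prime_iff_eq hp (by norm_num : Nat.Prime 7)).mp (hpi.dvd_of_dvd_pow h); omega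
    · have := (Nat.prime_dvd_prime_iff_eq hp (by norm_num : Nat.Prime 83)).mp (hpi.dvd_of_dvd_pow h); omega
  · have := (Nat.prime_dvd_prime_iff_eq hp (by norm_num : Nat.Prime 132049)).mp h; omega

/-! ## §2 The places of `ℚ(i)` above `2`, `3`, `7`, `83` -/

omit [IsCyclotomicExtension {4} ℚ K] in
/-- Every rational prime lies under some finite place. [cite: IrelandRosen1982, Ch. 9 §7] -/
private theorem exists_natCast_mem_asIdeal {ℓ : ℕ} (hℓ : ℓ.Prime) :
    ∃ v : HeightOneSpectrum (𝓞 K), (ℓ : 𝓞 K) ∈ v.asIdeal := by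
  haveI := Fact.mk hℓ
  obtain ⟨⟨P, hP, hPover⟩⟩ := (span {(ℓ : ℤ)}).nonempty_primesOver (S := 𝓞 K)
  have hℓZ : (ℓ : ℤ) ≠ 0 := Int.natCast_ne_zero.mpr hℓ.ne_zero
  have hP0 : P ≠ ⊥ := Ideal.ne_bot_of_liesOver_of_ne_bot (p := span {(ℓ : ℤ)}) (by simpa using hℓZ) P
  refine ⟨⟨P, hP, hP0⟩, ?_⟩
  have h : ((ℓ : ℤ) : ℤ) ∈ span {(ℓ : ℤ)} := mem_span_singleton_self _
  rw [mem_of_liesOver P] at h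
  simpa using h

/-- **The prime of `ℤ[i]` above `2` is unique** (`2 = -i(1+i)²` ramifies: `λ = ζ₄ - 1` has `λ² = -2ζ₄`, so a prime
containing `2` contains `λ`, and `(λ)` is maximal). [cite: IrelandRosen1982, Ch. 9 §7 Lemma 3] -/
theorem eq_of_two_mem {v w : HeightOneSpectrum (𝓞 K)} (hv : (2 : 𝓞 K) ∈ v.asIdeal) (hw : (2 : 𝓞 K) ∈ w.asIdeal) :
    v = w := by
  have hζ := IsCyclotomicExtension.zeta_spec 4 ℚ K
  haveI : IsCyclotomicExtension {2 ^ (1 + 1)} ℚ K := by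
    rw [show (2 : ℕ) ^ (1 + 1) = 4 by norm_num]; infer_instance
  have hζ' : IsPrimitiveRoot (IsCyclotomicExtension.zeta 4 ℚ K) (2 ^ (1 + 1)) := by
    rw [show (2 : ℕ) ^ (1 + 1) = 4 by norm_num]; exact hζ
  set l : 𝓞 K := hζ'.toInteger - 1 with hl
  have hlprime : Prime l := hζ'.zeta_sub_one_prime_of_two_pow
  -- `λ² = -2ζ`, so `λ² ∈ 𝔭` whenever `2 ∈ 𝔭`
  have hsqK : (IsCyclotomicExtension.zeta 4 ℚ K - 1) ^ 2 = -2 * IsCyclotomicExtension.zeta 4 ℚ K := by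
    have h2 : (IsCyclotomicExtension.zeta 4 ℚ K) ^ 2 = -1 :=
      (hζ.pow (by norm_num) (show 4 = 2 * 2 by norm_num)).eq_neg_one_of_two_right
    linear_combination h2
  have hsq : l ^ 2 = -2 * hζ'.toInteger := by
    apply Subtype.ext
    rw [hl]
    push_cast
    exact hsqK
  have hmem : ∀ u : HeightOneSpectrum (𝓞 K), (2 : 𝓞 K) ∈ u.asIdeal → l ∈ u.asIdeal := by
    intro u hu
    have h2 : l ^ 2 ∈ u.asIdeal := by
      rw [hsq, mul_comm]
      exact u.asIdeal.mul_mem_left _ (by simpa using u.asIdeal.neg_mem_iff.mpr hu)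
    exact (u.isPrime.pow_mem_iff_mem 2 (by norm_num)).mp h2
  -- `(λ)` is maximal, hence equal to every prime containing it
  have hmax : (span {l}).IsMaximal :=
    ((span_singleton_prime hlprime.ne_zero).mpr hlprime).isMaximal
      (by rw [Ne, span_singleton_eq_bot]; exact hlprime.ne_zero)
  have hveq : ∀ u : HeightOneSpectrum (𝓞 K), (2 : 𝓞 K) ∈ u.asIdeal → u.asIdeal = span {l} := fun u hu ↦
    (hmax.eq_of_le u.isPrime.ne_top ((span_singleton_le_iff_mem _).mpr (hmem u hu))).symm
  exact HeightOneSpectrum.ext (by rw [hveq v hv, hveq w hw])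

omit [IsCyclotomicExtension {4} ℚ K] in
/-- **The prime of `ℤ[i]` above an inert `q ≡ 3 (mod 4)` is unique** (it is `(q)`, tree
`eq_span_natCast_of_mem_of_mod_four_eq_three`). [cite: IrelandRosen1982, Ch. 9 §7 Lemma 4] -/
theorem eq_of_natCast_mem_of_mod_four_eq_three [IsCyclotomicExtension {4} ℚ K] {q : ℕ} (hq : q.Prime)
    (hq3 : q % 4 = 3) {v w : HeightOneSpectrum (𝓞 K)} (hv : (q : 𝓞 K) ∈ v.asIdeal) (hw : (q : 𝓞 K) ∈ w.asIdeal) :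
    v = w :=
  HeightOneSpectrum.ext (by
    rw [eq_span_natCast_of_mem_of_mod_four_eq_three hq hq3 v.isPrime hv,
      eq_span_natCast_of_mem_of_mod_four_eq_three hq hq3 w.isPrime hw])

/-- **A set of four places supporting `mn = 168 · 83 = 2³·3·7·83`**: there are places `v₂, v₃, v₇, v₈₃` of `ℚ(i)`
such that every place containing `168` or `83` is one of them. [cite: IrelandRosen1982, Ch. 9 §7 Lemmas 3–5] -/
theorem exists_support : ∃ S : Finset (HeightOneSpectrum (𝓞 K)), S.card ≤ 4 ∧
    ∀ v : HeightOneSpectrum (𝓞 K), v ∉ S →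
      (((168 : ℤ) : ℤ) : 𝓞 K) ∉ v.asIdeal ∧ (((83 : ℤ) : ℤ) : 𝓞 K) ∉ v.asIdeal := by
  obtain ⟨v₂, h₂⟩ := exists_natCast_mem_asIdeal (K := K) Nat.prime_two
  obtain ⟨v₃, h₃⟩ := exists_natCast_mem_asIdeal (K := K) Nat.prime_three
  obtain ⟨v₇, h₇⟩ := exists_natCast_mem_asIdeal (K := K) (by norm_num : Nat.Prime 7)
  obtain ⟨v₈₃, h₈₃⟩ := exists_natCast_mem_asIdeal (K := K) (by norm_num : Nat.Prime 83)
  refine ⟨{v₂, v₃, v₇, v₈₃}, Finset.card_le_four, fun v hv ↦ ?_⟩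
  simp only [Finset.mem_insert, Finset.mem_singleton, not_or] at hv
  obtain ⟨hv2, hv3, hv7, hv83⟩ := hv
  have hP := v.isPrime
  constructor
  · -- `168 = 2³ · 3 · 7`
    intro h168
    have e : (((168 : ℤ) : ℤ) : 𝓞 K) = (2 : 𝓞 K) ^ 3 * ((3 : ℕ) : 𝓞 K) * ((7 : ℕ) : 𝓞 K) := by push_cast; norm_num
    rw [e] at h168
    rcases hP.mem_or_mem h168 with h | h
    · rcases hP.mem_or_mem h with h | h
      · exact hv2 (eq_of_two_mem ((hP.pow_mem_iff_mem 3 (by norm_num)).mp h) (by exact_mod_cast h₂))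
      · exact hv3 (eq_of_natCast_mem_of_mod_four_eq_three Nat.prime_three (by norm_num) h h₃)
    · exact hv7 (eq_of_natCast_mem_of_mod_four_eq_three (by norm_num) (by norm_num) h h₇)
  · intro h83
    have e : (((83 : ℤ) : ℤ) : 𝓞 K) = ((83 : ℕ) : 𝓞 K) := by push_cast; rfl
    rw [e] at h83
    exact hv83 (eq_of_natCast_mem_of_mod_four_eq_three (by norm_num) (by norm_num) h83 h₈₃)

/-! ## §3 The reference point and the box over `ℚ(i)` -/

omit [IsCyclotomicExtension {4} ℚ K] in
/-- `P₁ = (-156, 1143792)` lies on `E_{168/83}` (over `K`; the point is the tree's, `KubertTate16883Descent`).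
[cite: Fisher2001FiveSevenDescent, §2 (the family; this member's points verified in-file)] -/
theorem nonsingular_P₁ : (kubertTateFive ((168 : ℤ) : K) ((83 : ℤ) : K)).toAffine.Nonsingular (-156) 1143792 := by
  haveI := isElliptic (K := K)
  rw [← Affine.equation_iff_nonsingular, KubertTateMuDescentNF.equation_iff_base (K := K) 168 83]
  push_cast
  norm_num

/-- Transport of `k • P = 0` for an affine point along an equality of curves (instances are propositions). [folklore] -/
private theorem nsmul_some_eq_zero_of_eq {F : Type*} [Field F] {V V' : WeierstrassCurve F} (e : V = V') {x y : F}
    (h : V.toAffine.Nonsingular x y) (h' : V'.toAffine.Nonsingular x y) (k : ℕ)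
    (h0 : k • (Affine.Point.some x y h : V.toAffine.Point) = 0) :
    k • (Affine.Point.some x y h' : V'.toAffine.Point) = 0 := by
  subst e; exact h0

/-- Two affine points with equal coordinates are equal (proof-irrelevant form). [folklore] -/
private theorem some_eq_some_of_eq {R : Type*} [CommRing R] {V : WeierstrassCurve R}
    {x y x' y' : R} (hx : x = x') (hy : y = y') (h : V.toAffine.Nonsingular x y)
    (h' : V.toAffine.Nonsingular x' y') : Affine.Point.some x y h = Affine.Point.some x' y' h' := by
  subst hx hy; rfl

omit [IsCyclotomicExtension {4} ℚ K] in
/-- **`25 · P₁ ≠ O` in `E(\overline{ℚ(i)})`** — transported from `ℚ` (tree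
`KubertTateFiveTorsion.twentyfive_zsmul_toGeomPoints_ne_zero`: `E(ℚ)[25] = ⟨T⟩` by reduction modulo `11`, and
`x(P₁) ∉ {0, mn}`) along the injections `E(ℚ) ↪ E(K) ↪ E(K̄)`. [cite: SilvermanAEC2009, VII.3.1(b) and VIII.§1] -/
theorem twentyfive_zsmul_P₁_ne_zero :
    ((25 : ℕ) : ℤ) • toGeomPoints (kubertTateFive ((168 : ℤ) : K) ((83 : ℤ) : K))
      (Affine.Point.some (-156) 1143792 nonsingular_P₁) ≠ 0 := by
  haveI := KubertTate16883Descent.isElliptic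
  haveI : Fact (Nat.Prime 11) := ⟨by norm_num⟩
  intro h0
  rw [natCast_zsmul] at h0
  -- down to `E(K)`: `25 • (-156, 1143792) = 0` in `E_{168/83}(K)`
  have h1 : (25 : ℕ) • (Affine.Point.some (-156) 1143792 nonsingular_P₁ :
      (kubertTateFive ((168 : ℤ) : K) ((83 : ℤ) : K)).toAffine.Point) = 0 := by
    apply toGeomPoints_injective (kubertTateFive ((168 : ℤ) : K) ((83 : ℤ) : K))
    rw [(toGeomPoints (kubertTateFive ((168 : ℤ) : K) ((83 : ℤ) : K))).map_nsmul, h0,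
      (toGeomPoints (kubertTateFive ((168 : ℤ) : K) ((83 : ℤ) : K))).map_zero]
  -- the same point on the base-changed model `E_{168/83} ⊗_ℚ K`
  have eC : (kubertTateFive (((168 : ℤ) : ℚ)) (((83 : ℤ) : ℚ))).baseChange K =
      kubertTateFive ((168 : ℤ) : K) ((83 : ℤ) : K) := KubertTateMuDescentNF.baseChange_eq (K := ℚ) 168 83 K
  have hK' : ((kubertTateFive (((168 : ℤ) : ℚ)) (((83 : ℤ) : ℚ))).baseChange K).toAffine.Nonsingular (-156) 1143792 := by
    rw [eC]; exact nonsingular_P₁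
  have h2 := nsmul_some_eq_zero_of_eq eC.symm nonsingular_P₁ hK' 25 h1
  -- over `ℚ`: the point and the injection `E(ℚ) ↪ (E ⊗ K)(K)`
  have hQ' : (kubertTateFive (((168 : ℤ) : ℚ)) (((83 : ℤ) : ℚ))).toAffine.Nonsingular (-156) 1143792 :=
    (KubertTate16883Descent.nonsingular_iff _ _).mpr (by norm_num)
  let ι : (kubertTateFive (((168 : ℤ) : ℚ)) (((83 : ℤ) : ℚ))).toAffine.Point →+
      ((kubertTateFive (((168 : ℤ) : ℚ)) (((83 : ℤ) : ℚ))).baseChange K).toAffine.Point :=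
    Affine.Point.map (W' := kubertTateFive (((168 : ℤ) : ℚ)) (((83 : ℤ) : ℚ))) (Algebra.ofId ℚ K)
  have hιinj : Function.Injective ι :=
    Affine.Point.map_injective (W' := kubertTateFive (((168 : ℤ) : ℚ)) (((83 : ℤ) : ℚ))) (f := Algebra.ofId ℚ K)
  have hx : (Algebra.ofId ℚ K) (-156 : ℚ) = (-156 : K) := by simp
  have hy : (Algebra.ofId ℚ K) (1143792 : ℚ) = (1143792 : K) := by simp
  have eι : ι (Affine.Point.some (-156) 1143792 hQ') = Affine.Point.some (-156) 1143792 hK' := by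
    change Affine.Point.map (W' := kubertTateFive (((168 : ℤ) : ℚ)) (((83 : ℤ) : ℚ))) (Algebra.ofId ℚ K)
      (Affine.Point.some (-156) 1143792 hQ') = _
    rw [Affine.Point.map_some]
    exact some_eq_some_of_eq hx hy _ _
  have h3 : (25 : ℕ) • (Affine.Point.some (-156) 1143792 hQ' :
      (kubertTateFive (((168 : ℤ) : ℚ)) (((83 : ℤ) : ℚ))).toAffine.Point) = 0 := by
    apply hιinj
    rw [ι.map_nsmul, eι, h2, ι.map_zero]
  -- contradiction with `25 P₁ ≠ O` over `ℚ` (`E(ℚ)[25] = ⟨T⟩`, `x(P₁) ∉ {0, mn}`); the tree lemma carries `E(ℚ)`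
  -- with the classical `DecidableEq ℚ`, bridged along `Subsingleton.elim`
  have hinst : (instDecidableEqRat : DecidableEq ℚ) = fun a b ↦ Classical.propDecidable _ := Subsingleton.elim _ _
  rw [hinst] at h3
  exact KubertTateFiveTorsion.twentyfive_nsmul_ne_zero (168) 83 11 (by norm_num) (by norm_num)
    KubertTate16883Descent.not_tor_dvd_Δ (h := hQ') (by norm_num) (by norm_num) h3

/-- Transport of the Mordell–Weil rank along an equality of curves. [folklore] -/
private theorem mordellWeilRank_congr {F : Type} [Field F] [NumberField F] {V V' : WeierstrassCurve F}
    [V.IsElliptic] [V'.IsElliptic] (e : V = V') : V.mordellWeilRank = V'.mordellWeilRank := by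
  subst e; rfl

/-- Transport of `t_p` along an equality of curves. [folklore] -/
private theorem shaCorank_congr {F : Type} [Field F] [NumberField F] {V V' : WeierstrassCurve F}
    [V.IsElliptic] [V'.IsElliptic] (e : V = V') (p : ℕ) [Fact p.Prime] : V.shaCorank p = V'.shaCorank p := by
  subst e; rfl

/-- `[ℚ(ζ₄) : ℚ] = 2`. [folklore] -/
private theorem finrank_rat_four : Module.finrank ℚ K = 2 := by
  rw [IsCyclotomicExtension.finrank (n := 4) K (Polynomial.cyclotomic.irreducible_rat (by norm_num)),
    show Nat.totient 4 = 2 by decide]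

/-- **`rank E_{168/83}(ℚ(i)) ≥ 3`**: `rank E(K) = rank E(ℚ) + rank E^{(d_K)}(ℚ) ≥ rank E(ℚ) = 3` (tree
`mordellWeilRank_baseChange_quadratic_holds`, `KubertTate16883Descent.mordellWeilRank_eq`).
[cite: SilvermanAEC2009, Exercise 10.16] -/
theorem three_le_mordellWeilRank :
    haveI := isElliptic (K := K)
    3 ≤ (kubertTateFive ((168 : ℤ) : K) ((83 : ℤ) : K)).mordellWeilRank := by
  haveI := isElliptic (K := K)
  haveI := KubertTate16883Descent.isElliptic
  haveI : ((kubertTateFive (((168 : ℤ) : ℚ)) (((83 : ℤ) : ℚ))).baseChange K).IsElliptic := by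
    rw [KubertTateMuDescentNF.baseChange_eq (K := ℚ) 168 83 K]; exact isElliptic
  have hd : ((NumberField.discr K : ℤ) : ℚ) ≠ 0 := by exact_mod_cast NumberField.discr_ne_zero K
  haveI : ((kubertTateFive (((168 : ℤ) : ℚ)) (((83 : ℤ) : ℚ))).quadraticTwist (NumberField.discr K : ℚ)).IsElliptic :=
    isElliptic_quadraticTwist _ hd
  have hR := mordellWeilRank_baseChange_quadratic_holds (kubertTateFive (((168 : ℤ) : ℚ)) (((83 : ℤ) : ℚ))) K
    finrank_rat_four
  rw [mordellWeilRank_congr (KubertTateMuDescentNF.baseChange_eq (K := ℚ) 168 83 K),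
    KubertTate16883Descent.mordellWeilRank_eq] at hR
  omega

/-- **The box over `ℚ(i)` is full**: `5 ^ #S ≤ 5⁴ ≤ #(E(ℚ(i))/5E(ℚ(i))) = 5^{rank} · #E(ℚ(i))[5]` for any `S` with
`#S ≤ 4` (`rank ≥ 3`, and `T = (0,0)` has order `5`). [cite: SilvermanAEC2009, Thm. X.4.2] -/
theorem box_full (S : Finset (HeightOneSpectrum (𝓞 K))) (hS4 : S.card ≤ 4) :
    haveI := isElliptic (K := K)
    5 ^ S.card ≤ Nat.card ((kubertTateFive ((168 : ℤ) : K) ((83 : ℤ) : K)).toAffine.Point ⧸ (nsmulAddMonoidHom (5 : ℕ) :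
      (kubertTateFive ((168 : ℤ) : K) ((83 : ℤ) : K)).toAffine.Point →+
        (kubertTateFive ((168 : ℤ) : K) ((83 : ℤ) : K)).toAffine.Point).range) := by
  haveI := isElliptic (K := K)
  set E := kubertTateFive ((168 : ℤ) : K) ((83 : ℤ) : K) with hEdef
  haveI : Module.Finite ℤ E.toAffine.Point := by convert module_finite_point_holds E
  rw [natCard_quotient_nsmulRange_eq E.toAffine.Point 5]
  -- `#E(K)[5] ≥ 5`
  obtain ⟨hm0, hn0, -⟩ := ne_zero_of_isElliptic ((168 : ℤ) : K) ((83 : ℤ) : K)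
  obtain ⟨T, hT⟩ := exists_addOrderOf_eq_five_kubertTateFive hm0 hn0
  have h5T : 5 ≤ Nat.card (AddSubgroup.torsionBy E.toAffine.Point ((5 : ℕ) : ℤ)) := by
    haveI : Finite (AddSubgroup.torsionBy E.toAffine.Point ((5 : ℕ) : ℤ)) :=
      Literature.NumberTheory.EllipticCurves.finite_torsionBy_of_injective
        (toGeomPoints E) (toGeomPoints_injective _) _
        (WeierstrassCurve.finite_torsionBy_of_isAlgClosed (V := E.baseChange (AlgebraicClosure K)) (by norm_num))
    have hsub : AddSubgroup.zmultiples T ≤ AddSubgroup.torsionBy _ ((5 : ℕ) : ℤ) := by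
      rw [AddSubgroup.zmultiples_le, mem_torsionBy_iff, natCast_zsmul, ← hT, addOrderOf_nsmul_eq_zero]
    have := AddSubgroup.card_le_of_le hsub
    rwa [Nat.card_zmultiples, hT] at this
  -- `finrank = rank ≥ 3`
  have hr : Module.finrank ℤ E.toAffine.Point = E.mordellWeilRank := by
    unfold WeierstrassCurve.mordellWeilRank; congr!
  have h3 := three_le_mordellWeilRank (K := K)
  rw [← hEdef, ← hr] at h3
  calc 5 ^ S.card ≤ 5 ^ 4 := Nat.pow_le_pow_right (by norm_num) hS4
    _ = 5 ^ 3 * 5 := by norm_num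
    _ ≤ 5 ^ Module.finrank ℤ E.toAffine.Point * Nat.card (AddSubgroup.torsionBy E.toAffine.Point ((5 : ℕ) : ℤ)) :=
        Nat.mul_le_mul (Nat.pow_le_pow_right (by norm_num) h3) h5T

/-! ## §4 The theorems -/

/-- **`t₅(E_{168/83} ⊗ ℚ(i)) = corank_{ℤ₅} Ш(E_{168/83}/ℚ(i))[5^∞] = 0`, UNCONDITIONALLY**, by the complete `5`-descent
over `ℚ(i)` (`KubertTateMuDescentNF.shaCorank_five_eq_zero_of_le`). [cite: SilvermanAEC2009, Thm. X.4.2(a)]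
[cite: Fisher2001FiveSevenDescent, §2] -/
theorem shaCorank_five_eq_zero :
    haveI := isElliptic (K := K)
    (kubertTateFive ((168 : ℤ) : K) ((83 : ℤ) : K)).shaCorank 5 = 0 := by
  haveI := isElliptic (K := K)
  obtain ⟨S, hS4, hS⟩ := exists_support (K := K)
  exact KubertTateMuDescentNF.shaCorank_five_eq_zero_of_le 168 83
    (toGeomPoints _ (Affine.Point.some (-156) 1143792 nonsingular_P₁)) (fun σ ↦ smul_toGeomPoints _ σ _)
    twentyfive_zsmul_P₁_ne_zero S hS KubertTate16883Descent.not_five_dvd_Δ gaussian_tame (box_full S hS4)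

/-- **`Ш(E_{168/83}/ℚ(i))[5] = 0`, unconditionally.** [cite: SilvermanAEC2009, Thm. X.4.2(a)] -/
theorem sha_torsionBy_five_eq_bot :
    haveI := isElliptic (K := K)
    (kubertTateFive ((168 : ℤ) : K) ((83 : ℤ) : K)).sha[((5 : ℕ) : ℤ)] = ⊥ := by
  haveI := isElliptic (K := K)
  obtain ⟨S, hS4, hS⟩ := exists_support (K := K)
  exact KubertTateMuDescentNF.sha_torsionBy_five_eq_bot_of_le 168 83
    (toGeomPoints _ (Affine.Point.some (-156) 1143792 nonsingular_P₁)) (fun σ ↦ smul_toGeomPoints _ σ _)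
    twentyfive_zsmul_P₁_ne_zero S hS KubertTate16883Descent.not_five_dvd_Δ gaussian_tame (box_full S hS4)

/-- **`rank E_{168/83}(ℚ(i)) = 3`, unconditionally** (`≥ 3` from `ℚ`; `rank + 1 ≤ #S ≤ 4` from the descent over
`ℚ(i)`, `KubertTateMuDescentNF.mordellWeilRank_succ_le`). [cite: SilvermanAEC2009, Thm. X.4.2 and Exercise 10.16] -/
theorem mordellWeilRank_eq_three :
    haveI := isElliptic (K := K)
    (kubertTateFive ((168 : ℤ) : K) ((83 : ℤ) : K)).mordellWeilRank = 3 := by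
  haveI := isElliptic (K := K)
  obtain ⟨S, hS4, hS⟩ := exists_support (K := K)
  obtain ⟨ψ, hψ⟩ := KubertTateMuDescentNF.exists_dual (K := K) 168 83
  have hle := KubertTateMuDescentNF.mordellWeilRank_succ_le 168 83 ψ hψ
    (toGeomPoints _ (Affine.Point.some (-156) 1143792 nonsingular_P₁)) (fun σ ↦ smul_toGeomPoints _ σ _)
    twentyfive_zsmul_P₁_ne_zero S hS KubertTate16883Descent.not_five_dvd_Δ gaussian_tame
  have h3 := three_le_mordellWeilRank (K := K)
  omega

/-- **`rank E_{168/83}^{(-4)}(ℚ) = 0`, unconditionally**: `rank E(ℚ(i)) = rank E(ℚ) + rank E^{(-4)}(ℚ)`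
(`d_{ℚ(i)} = -4`) with `3 = 3 + rank E^{(-4)}(ℚ)`. [cite: SilvermanAEC2009, Exercise 10.16] -/
theorem mordellWeilRank_twist_eq_zero (K : Type) [Field K] [NumberField K] [IsCyclotomicExtension {4} ℚ K]
    [((kubertTateFive (((168 : ℤ) : ℚ)) (((83 : ℤ) : ℚ))).quadraticTwist (-4)).IsElliptic] :
    ((kubertTateFive (((168 : ℤ) : ℚ)) (((83 : ℤ) : ℚ))).quadraticTwist (-4)).mordellWeilRank = 0 := by
  haveI := isElliptic (K := K)
  haveI := KubertTate16883Descent.isElliptic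
  haveI : ((kubertTateFive (((168 : ℤ) : ℚ)) (((83 : ℤ) : ℚ))).baseChange K).IsElliptic := by
    rw [KubertTateMuDescentNF.baseChange_eq (K := ℚ) 168 83 K]; exact isElliptic
  have hd : ((NumberField.discr K : ℤ) : ℚ) ≠ 0 := by exact_mod_cast NumberField.discr_ne_zero K
  haveI : ((kubertTateFive (((168 : ℤ) : ℚ)) (((83 : ℤ) : ℚ))).quadraticTwist (NumberField.discr K : ℚ)).IsElliptic :=
    isElliptic_quadraticTwist _ hd
  have hR := mordellWeilRank_baseChange_quadratic_holds (kubertTateFive (((168 : ℤ) : ℚ)) (((83 : ℤ) : ℚ))) K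
    finrank_rat_four
  rw [mordellWeilRank_congr (KubertTateMuDescentNF.baseChange_eq (K := ℚ) 168 83 K),
    KubertTate16883Descent.mordellWeilRank_eq, mordellWeilRank_eq_three (K := K)] at hR
  have h4 : ((NumberField.discr K : ℤ) : ℚ) = -4 := by rw [discr_of_isCyclotomicExtension_four K]; norm_num
  rw [h4] at hR
  omega

/-- **`t₅(E_{168/83}^{(-4)}/ℚ) = 0`, unconditionally** — the door at `5` on the twist, a curve WITHOUT a rational
`5`-torsion point: `t₅(E_K) = t₅(E) + t₅(E^{(d_K)})` (`corank Sel(E_K) = corank Sel(E) + corank Sel(E^{(d_K)})`, tree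
`selmerCorank_baseChange_quadratic_holds`; `rank E(K) = rank E + rank E^{(d_K)}`; Greenberg's
`corank Sel = rank + t`) with `t₅(E_K) = 0`. [cite: Dokchitser2013ParityNotes, §4] [cite: SilvermanAEC2009, Thm. X.4.2] -/
theorem shaCorank_five_twist_eq_zero (K : Type) [Field K] [NumberField K] [IsCyclotomicExtension {4} ℚ K]
    [((kubertTateFive (((168 : ℤ) : ℚ)) (((83 : ℤ) : ℚ))).quadraticTwist (-4)).IsElliptic] :
    ((kubertTateFive (((168 : ℤ) : ℚ)) (((83 : ℤ) : ℚ))).quadraticTwist (-4)).shaCorank 5 = 0 := by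
  haveI : Fact (Nat.Prime 5) := ⟨Nat.prime_five⟩
  haveI := isElliptic (K := K)
  haveI := KubertTate16883Descent.isElliptic
  set W := kubertTateFive (((168 : ℤ) : ℚ)) (((83 : ℤ) : ℚ)) with hW
  haveI hbc : (W.baseChange K).IsElliptic := by
    rw [hW, KubertTateMuDescentNF.baseChange_eq (K := ℚ) 168 83 K]; exact isElliptic
  have hd : ((NumberField.discr K : ℤ) : ℚ) ≠ 0 := by exact_mod_cast NumberField.discr_ne_zero K
  haveI : (W.quadraticTwist (NumberField.discr K : ℚ)).IsElliptic := isElliptic_quadraticTwist _ hd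
  have hS := selmerCorank_baseChange_quadratic_holds W K finrank_rat_four 5
  have hR := mordellWeilRank_baseChange_quadratic_holds W K finrank_rat_four
  have hK := (W.baseChange K).selmerCorank_eq_mordellWeilRank_add_holds 5
  have hQ := W.selmerCorank_eq_mordellWeilRank_add_holds 5
  have hT := (W.quadraticTwist (NumberField.discr K : ℚ)).selmerCorank_eq_mordellWeilRank_add_holds 5
  have h0 : (W.baseChange K).shaCorank 5 = 0 := by
    rw [shaCorank_congr (KubertTateMuDescentNF.baseChange_eq (K := ℚ) 168 83 K) 5]
    exact shaCorank_five_eq_zero (K := K)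
  have h4 : ((NumberField.discr K : ℤ) : ℚ) = -4 := by rw [discr_of_isCyclotomicExtension_four K]; norm_num
  rw [h4] at hS hR hT
  omega

end KubertTate16883GaussianDescent

end Literature.NumberTheory.EllipticCurves

end
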